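import Mathlib
import Summits.Ventures.PercRepro2.TypedUnmarkedCount
import Summits.Ventures.PercRepro2.HCovTyped

/-!
# Row 2′TRI and (HCOV) on `|V| ≤ |marks| + k` from the residual instances with at most `k`
unmarked typed vertices (blind cell PercRepro2, mine-2 g42, 2026-08-29; `proofs/MINE2-SIXV.md` §4)

The hereditary spine (TypedSpineHered.lean) with the hereditary count of TypedUnmarkedCount.lean,
stated once for every `k`: row 2′TRI on every vertex type with at most `k` vertices outside the
marks follows from row 2′TRI on the RESIDUAL instances with at most `k` unmarked typed vertices
(`TypedBases_of_card_le_of_residual`), and so does (HCOV) for every admissible weight vector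
(`HCov_of_card_le_of_residual`).  The case `k = 1` is TypedSixVertex.lean (the residual side a
theorem); the case `k = 2` is the exact open content of a seven-vertex theorem
(`HCov_of_card_le_seven_of_residual`): the residual instances with two unmarked typed vertices —
two disjoint stars into the marks, or the adjacent pair `u ~ w`.

Own code; standard axioms.
-/

namespace Summit.Ventures.PercRepro2

open UnionCluster

namespace CovForm

namespace TypedRed

section Reduction

variable {V : Type*} {E : Type*} [Fintype V] [DecidableEq V] [Fintype E] [DecidableEq E]
variable {R : Type*} [Field R] [LinearOrder R] [IsStrictOrderedRing R]

/-- **Row 2′TRI on `|V| ≤ |marks| + k` from the residual instances with at most `k` unmarked typed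
vertices** (the hereditary spine with the hereditary count). -/
theorem TypedBases_of_card_le_of_residual (k : ℕ)
    (hNR : ∀ (ends : E → Sym2 V) (o a₁ a₂ a₃ b : V) (F : Finset E) (τ : E → ℕ),
      (∀ e ∈ F, τ e = 1 ∨ τ e = 2) → Residual ends o a₁ a₂ a₃ b F →
        (unmarkedTyped ends o a₁ a₂ a₃ b F).card ≤ k →
        0 ≤ typedCount F (fun _ => false) τ
          (K3 ends o a₁ a₂ a₃ b : Config E → Config E → Config E → R))
    (ends : E → Sym2 V) (o a₁ a₂ a₃ b : V)
    (hV : Fintype.card V ≤ (markSet o a₁ a₂ a₃ b).card + k) :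
    TypedBases (R := R) ends o a₁ a₂ a₃ b :=
  TypedBases_of_residual_hered (hereditary_unmarked_le k) hNR ends o a₁ a₂ a₃ b
    (fun F => by have := card_unmarkedTyped_le ends o a₁ a₂ a₃ b F; omega)

/-- **(HCOV) on `|V| ≤ |marks| + k` from the residual instances with at most `k` unmarked typed
vertices**, for every admissible weight vector. -/
theorem HCov_of_card_le_of_residual (k : ℕ)
    (hNR : ∀ (ends : E → Sym2 V) (o a₁ a₂ a₃ b : V) (F : Finset E) (τ : E → ℕ),
      (∀ e ∈ F, τ e = 1 ∨ τ e = 2) → Residual ends o a₁ a₂ a₃ b F →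
        (unmarkedTyped ends o a₁ a₂ a₃ b F).card ≤ k →
        0 ≤ typedCount F (fun _ => false) τ
          (K3 ends o a₁ a₂ a₃ b : Config E → Config E → Config E → R))
    (ends : E → Sym2 V) (p : E → R) (hp : IsProbVec p) (o a₁ a₂ a₃ b : V)
    (hV : Fintype.card V ≤ (markSet o a₁ a₂ a₃ b).card + k) :
    HCov p ends o a₁ a₂ a₃ b :=
  HCov_of_typedBases ends o a₁ a₂ a₃ b
    (TypedBases_of_card_le_of_residual k hNR ends o a₁ a₂ a₃ b hV) p hp

/-- **Seven vertices**: (HCOV) on every graph with at most seven vertices and five distinct marks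
follows from row 2′TRI on the residual instances with at most TWO unmarked typed vertices — the
exact open content of a seven-vertex theorem. -/
theorem HCov_of_card_le_seven_of_residual
    (hNR : ∀ (ends : E → Sym2 V) (o a₁ a₂ a₃ b : V) (F : Finset E) (τ : E → ℕ),
      (∀ e ∈ F, τ e = 1 ∨ τ e = 2) → Residual ends o a₁ a₂ a₃ b F →
        (unmarkedTyped ends o a₁ a₂ a₃ b F).card ≤ 2 →
        0 ≤ typedCount F (fun _ => false) τ
          (K3 ends o a₁ a₂ a₃ b : Config E → Config E → Config E → R))
    (ends : E → Sym2 V) (p : E → R) (hp : IsProbVec p) (o a₁ a₂ a₃ b : V)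
    (hV : Fintype.card V ≤ 7) (h12 : a₁ ≠ a₂) (h13 : a₁ ≠ a₃) (h23 : a₂ ≠ a₃) (ho1 : o ≠ a₁)
    (ho2 : o ≠ a₂) (ho3 : o ≠ a₃) (hob : o ≠ b) (hb1 : b ≠ a₁) (hb2 : b ≠ a₂) (hb3 : b ≠ a₃) :
    HCov p ends o a₁ a₂ a₃ b :=
  HCov_of_card_le_of_residual 2 hNR ends p hp o a₁ a₂ a₃ b
    (by rw [card_markSet_of_distinct h12 h13 h23 ho1 ho2 ho3 hob hb1 hb2 hb3]; omega)

end Reduction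

end TypedRed

end CovForm

end Summit.Ventures.PercRepro2
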